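import Mathlib.NumberTheory.SumTwoSquares
import Mathlib.NumberTheory.LegendreSymbol.JacobiSymbol
import Mathlib.NumberTheory.Padics.PadicVal.Basic
import Literature.NumberTheory.Waring.LegendreThreeSquares
import Summits.BirchSwinnertonDyer.BirchSwinnertonDyer.Theorems.BiquadraticEisensteinDescentHeegnerTwistCouplingInSupplyThreeSquaresPin
import HarnessLib

set_option linter.dupNamespace false -- `Summit.BirchSwinnertonDyer.BirchSwinnertonDyer.Theorems.…` (summit = sub)
set_option autoImplicit false

/-!
# Crux `HeegnerTwistCouplingInSupply` (stmt-BirchSwinnertonDyer-21381) — the DUAL three-squares pin of type `(3,−)`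
# (card `three-squares-heegner-pin`, second lemma `TernaryPinThreeMinus`), PROVED for `p ≡ 7 (mod 8)`

Route `BiquadraticEisensteinDescent` (cell `pub/bsd-wall`, row-12 line lead `bsd-line-ibd-p1` g10). Companion of
`…ThreeSquaresPin.lean` (p642610: the `(5,−)`-pin `threeSquaresPin` for every prime `p ≡ 3 (mod 4)`). Here: the card's
second pin, used with the partner prime `5` for its corner `E_{2p}`, `p ≡ ±1 (mod 5)` (`K′ = ℚ(√−5ℓ′)`). THEOREMS ONLY;
nothing about the crux (the coupling on the tail), `L`-values, class numbers or any case of BSD is asserted.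
Supports stmt-BirchSwinnertonDyer-21381 (typed sub-corner rung, not the crux).

The card's second pin `TernaryPinThreeMinus` (a prime `ℓ′ < p`, `ℓ′ ≡ 3 (mod 8)`, `(ℓ′/p) = −1`, read off
`p = u² + 2v² + w²`, `u = (x+y)/2`, `w = (x−y)/2`, `v = z/2` for a three-square representation `2p = x² + y² + z²` with
`x, y` odd): `u² + 2v² = p − w² ≡ 3 (mod 8)` has a prime factor `ℓ′ ≡ 3 (mod 8)` (primes `≡ 5, 7 (mod 8)` divide
`u² + 2v²` to even powers since `−2` is a non-residue there), `w² ≡ p (mod ℓ′)` gives `(p/ℓ′) = +1`, and reciprocity at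
two primes `≡ 3 (mod 4)` gives `(ℓ′/p) = −1`. The bound `ℓ′ < p` needs `w ≠ 0`, i.e. a NON-DEGENERATE representation
(`x ≠ y`); for `p ≡ 7 (mod 8)` every representation is non-degenerate (`x = y` would force `p = x² + 2(z/2)² ≡ 3 (mod 8)`),
so the dual pin is a THEOREM for `p ≡ 7 (mod 8)` (proved below, no size hypothesis). For `p ≡ 3 (mod 8)` the card needs a
representation count (`r₃(2p) = 12·h(−8p) > 24`, i.e. `p ∉ {3, 11}`), which the tree does not hold — NOT proved here.
-/

namespace Summit.BirchSwinnertonDyer.BirchSwinnertonDyer.Theorems.BiquadraticEisensteinDescentHeegnerTwistCouplingInSupplyThreeSquaresPinDual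

open Literature.NumberTheory.Waring
open Summit.BirchSwinnertonDyer.BirchSwinnertonDyer.Theorems.BiquadraticEisensteinDescentHeegnerTwistCouplingInSupplyThreeSquaresPin

/-- Squares modulo `8`: an odd number has square `≡ 1`, a number `≡ 2 (mod 4)` has square `≡ 4`, a multiple of `4` has
square `≡ 0 (mod 8)`. [folklore] -/
theorem sq_mod_eight_cases (c : ℕ) :
    (c % 2 = 1 ∧ c ^ 2 % 8 = 1) ∨ (c % 4 = 2 ∧ c ^ 2 % 8 = 4) ∨ (c % 4 = 0 ∧ c ^ 2 % 8 = 0) := by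
  have key : ∀ r : ℕ, r < 8 →
      (r % 2 = 1 ∧ r ^ 2 % 8 = 1) ∨ (r % 4 = 2 ∧ r ^ 2 % 8 = 4) ∨ (r % 4 = 0 ∧ r ^ 2 % 8 = 0) := by
    decide
  have h := key (c % 8) (Nat.mod_lt c (by norm_num))
  rw [Nat.pow_mod]
  omega

/-- From `x² + y² + z² = n` with `n ≡ 6 (mod 8)`: a representation with the first two coordinates odd and the third
`≡ 2 (mod 4)` (the squares are `{1, 1, 4} (mod 8)`; permute). [folklore] -/
theorem exists_odd_sq_add_odd_sq_add_sq {x y z n : ℕ} (h : x ^ 2 + y ^ 2 + z ^ 2 = n) (hn : n % 8 = 6) :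
    ∃ a b c : ℕ, a ^ 2 + b ^ 2 + c ^ 2 = n ∧ a % 2 = 1 ∧ b % 2 = 1 ∧ c % 4 = 2 := by
  rcases sq_mod_eight_cases x with ⟨hx, hx8⟩ | ⟨hx, hx8⟩ | ⟨hx, hx8⟩ <;>
  rcases sq_mod_eight_cases y with ⟨hy, hy8⟩ | ⟨hy, hy8⟩ | ⟨hy, hy8⟩ <;>
  rcases sq_mod_eight_cases z with ⟨hz, hz8⟩ | ⟨hz, hz8⟩ | ⟨hz, hz8⟩
  all_goals first
    | exact ⟨x, y, z, h, hx, hy, hz⟩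
    | exact ⟨x, z, y, by rw [← h]; ring, hx, hz, hy⟩
    | exact ⟨y, z, x, by rw [← h]; ring, hy, hz, hx⟩
    | (exfalso; omega)

/-- **Primes `q ≡ 5, 7 (mod 8)` divide `u² + 2v²` to an even power** (`−2` is a non-residue modulo such `q`, Mathlib
`ZMod.exists_sq_eq_neg_two_iff`, so `q ∣ u² + 2v²` forces `q ∣ u`, `q ∣ v`; descend). [folklore] -/
theorem even_padicValNat_sq_add_two_mul_sq {q : ℕ} (hq : q.Prime) (hq8 : q % 8 = 5 ∨ q % 8 = 7) :
    ∀ m u v : ℕ, u ^ 2 + 2 * v ^ 2 = m → m ≠ 0 → Even (padicValNat q m) := by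
  haveI : Fact q.Prime := ⟨hq⟩
  have hq2 : q ≠ 2 := by
    rintro rfl
    omega
  intro m
  induction m using Nat.strong_induction_on with
  | _ m ih =>
    intro u v huv hm0
    by_cases hqm : q ∣ m
    · -- `q ∣ v` (else `−2` would be a square mod `q`), then `q ∣ u`
      have hzero : ((u ^ 2 + 2 * v ^ 2 : ℕ) : ZMod q) = 0 := by
        rw [huv]
        exact (ZMod.natCast_eq_zero_iff m q).mpr hqm
      push_cast at hzero
      have hqv : q ∣ v := by
        by_contra hv
        have hv0 : (v : ZMod q) ≠ 0 := by
          intro h0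
          exact hv ((ZMod.natCast_eq_zero_iff v q).mp h0)
        have hsq : IsSquare (-2 : ZMod q) := by
          refine ⟨(u : ZMod q) / (v : ZMod q), ?_⟩
          field_simp
          linear_combination -hzero
        have := (ZMod.exists_sq_eq_neg_two_iff hq2).mp hsq
        omega
      have hqu : q ∣ u := by
        have hqu2 : q ∣ u ^ 2 := by
          have h1 : q ∣ 2 * v ^ 2 := Dvd.dvd.mul_left (dvd_pow hqv two_ne_zero) 2
          have h2 : q ∣ u ^ 2 + 2 * v ^ 2 := huv ▸ hqm
          have h3 := Nat.dvd_sub h2 h1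
          simpa using h3
        exact hq.dvd_of_dvd_pow hqu2
      obtain ⟨u', rfl⟩ := hqu
      obtain ⟨v', rfl⟩ := hqv
      -- `m = q² · m'` with `m' = u'² + 2 v'²`
      have hm : m = q ^ 2 * (u' ^ 2 + 2 * v' ^ 2) := by rw [← huv]; ring
      have hq0 : q ≠ 0 := hq.ne_zero
      have hm'0 : u' ^ 2 + 2 * v' ^ 2 ≠ 0 := by
        intro h0
        apply hm0
        rw [hm, h0, mul_zero]
      have hlt : u' ^ 2 + 2 * v' ^ 2 < m := by
        have hq2' : 2 ≤ q := hq.two_le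
        have h4 : 4 ≤ q ^ 2 := by nlinarith
        have hpos : 0 < u' ^ 2 + 2 * v' ^ 2 := Nat.pos_of_ne_zero hm'0
        rw [hm]
        nlinarith
      have ih' := ih _ hlt u' v' rfl hm'0
      rw [hm, padicValNat.mul (pow_ne_zero 2 hq0) hm'0, padicValNat.prime_pow]
      exact (even_two).add ih'
    · rw [padicValNat.eq_zero_of_not_dvd hqm]
      exact ⟨0, rfl⟩

/-- **Mod-`8` bookkeeping, general form.** An odd natural number each of whose prime factors is `≡ 1 (mod 8)` or occurs
to an even power is `≡ 1 (mod 8)` (odd squares are `≡ 1 (mod 8)`). [folklore] -/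
theorem cast_zmod_eight_eq_one_of_even {a : ℕ} (ha0 : a ≠ 0) (hodd : a % 2 = 1)
    (h : ∀ q ∈ a.primeFactors, q % 8 = 1 ∨ Even (a.factorization q)) :
    (a : ZMod 8) = 1 := by
  conv_lhs => rw [← Nat.prod_factorization_pow_eq_self ha0]
  rw [Finsupp.prod, Nat.support_factorization, Nat.cast_prod]
  refine Finset.prod_eq_one fun q hq => ?_
  rw [Nat.cast_pow]
  have hqp : q.Prime := Nat.prime_of_mem_primeFactors hq
  have hqdvd : q ∣ a := Nat.dvd_of_mem_primeFactors hq
  have hq2 : q ≠ 2 := by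
    rintro rfl
    omega
  have hqodd : q % 2 = 1 := Nat.odd_iff.mp (hqp.odd_of_ne_two hq2)
  have hcast : (q : ZMod 8) = ((q % 8 : ℕ) : ZMod 8) := (ZMod.natCast_mod q 8).symm
  rcases h q hq with h1 | ⟨k, hk⟩
  · rw [hcast, h1, Nat.cast_one, one_pow]
  · have hsq : (q : ZMod 8) ^ 2 = 1 := by
      have key : ∀ r : ℕ, r < 8 → r % 2 = 1 → ((r : ZMod 8)) ^ 2 = 1 := by decide
      rw [hcast]
      exact key (q % 8) (Nat.mod_lt q (by norm_num)) (by omega)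
    rw [hk, ← two_mul, pow_mul, hsq, one_pow]

/-- **A number `u² + 2v² ≡ 3 (mod 8)` has a prime factor `≡ 3 (mod 8)`** (by `even_padicValNat_sq_add_two_mul_sq` and
`cast_zmod_eight_eq_one_of_even`: otherwise it would be `≡ 1 (mod 8)`). [folklore] -/
theorem exists_prime_dvd_mod_eight_eq_three {m u v : ℕ} (huv : u ^ 2 + 2 * v ^ 2 = m) (hm : m % 8 = 3) :
    ∃ ℓ : ℕ, ℓ.Prime ∧ ℓ ∣ m ∧ ℓ % 8 = 3 := by
  by_contra! H
  have hm0 : m ≠ 0 := by omega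
  have h1 : (m : ZMod 8) = 1 := by
    refine cast_zmod_eight_eq_one_of_even hm0 (by omega) fun q hq => ?_
    have hqp : q.Prime := Nat.prime_of_mem_primeFactors hq
    have hqdvd : q ∣ m := Nat.dvd_of_mem_primeFactors hq
    have hq2 : q ≠ 2 := by
      rintro rfl
      omega
    have hqodd : q % 2 = 1 := Nat.odd_iff.mp (hqp.odd_of_ne_two hq2)
    have hq3 : q % 8 ≠ 3 := H q hqp hqdvd
    by_cases hq1 : q % 8 = 1
    · exact Or.inl hq1
    · right
      rw [Nat.factorization_def m hqp]
      exact even_padicValNat_sq_add_two_mul_sq hqp (by omega) m u v huv hm0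
  have h3 : (m : ZMod 8) = ((3 : ℕ) : ZMod 8) := by
    rw [← ZMod.natCast_mod m 8, hm]
  rw [h3] at h1
  exact absurd h1 (by decide)

/-- **The dual pin with its certificate, `p ≡ 7 (mod 8)`.** For a prime `p ≡ 7 (mod 8)` there are `u v w ℓ : ℕ` with
`u² + 2v² + w² = p`, `u` odd, `w` even, `w ≠ 0`, and `ℓ` a prime `≡ 3 (mod 8)` dividing `u² + 2v² = p − w²`; any such `ℓ`
has `ℓ < p` and `(ℓ/p) = −1`. (Three squares for `2p`; `u, w = (x ± y)/2`, `v = z/2`; non-degeneracy is automatic at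
`p ≡ 7 (mod 8)`.) [folklore] -/
theorem exists_ternary_certificate {p : ℕ} (hp : p.Prime) (hp8 : p % 8 = 7) :
    ∃ u v w ℓ : ℕ, u ^ 2 + 2 * v ^ 2 + w ^ 2 = p ∧ u % 2 = 1 ∧ w % 2 = 0 ∧ w ≠ 0 ∧ ℓ.Prime ∧
      ℓ ∣ u ^ 2 + 2 * v ^ 2 ∧ ℓ % 8 = 3 ∧ ℓ < p ∧ jacobiSym (ℓ : ℤ) p = -1 := by
  have h4 : ¬ 4 ∣ 2 * p := by omega
  obtain ⟨x₀, y₀, z₀, h₀⟩ := (sum_three_squares_iff_mod_eight h4).mpr (by omega)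
  obtain ⟨a, b, c, habc, ha, hb, hc⟩ := exists_odd_sq_add_odd_sq_add_sq h₀ (by omega)
  -- `v = c / 2` (odd), and `{u, w} = {(a + b)/2, |a − b|/2}` with `u` odd, `w` even
  obtain ⟨v, rfl⟩ : ∃ v, c = 2 * v := ⟨c / 2, by omega⟩
  have hv : v % 2 = 1 := by omega
  -- the two half-sums, in `ℕ`: `s = (a + b)/2`, `t = (max - min)/2`; `s² + t² = (a² + b²)/2`
  obtain ⟨s, hs⟩ : ∃ s, a + b = 2 * s := ⟨(a + b) / 2, by omega⟩
  obtain ⟨t, ht⟩ : ∃ t, (max a b - min a b) = 2 * t := ⟨(max a b - min a b) / 2, by omega⟩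
  have hst : s ^ 2 + t ^ 2 + 2 * v ^ 2 = p := by
    rcases le_total a b with hab | hab
    · rw [max_eq_right hab, min_eq_left hab] at ht
      have hb' : b = a + 2 * t := by omega
      subst hb'
      have hs' : s = a + t := by omega
      subst hs'
      nlinarith [habc]
    · rw [max_eq_left hab, min_eq_right hab] at ht
      have ha' : a = b + 2 * t := by omega
      subst ha'
      have hs' : s = b + t := by omega
      subst hs'
      nlinarith [habc]
  -- exactly one of `s`, `t` is odd (`s + t = max a b` is odd)
  have hpar : (s % 2 = 1 ∧ t % 2 = 0) ∨ (s % 2 = 0 ∧ t % 2 = 1) := by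
    rcases le_total a b with hab | hab
    · rw [max_eq_right hab, min_eq_left hab] at ht
      omega
    · rw [max_eq_left hab, min_eq_right hab] at ht
      omega
  -- choose `u` odd, `w` even among `s`, `t`
  obtain ⟨u, w, huw, hu, hw⟩ : ∃ u w : ℕ, u ^ 2 + 2 * v ^ 2 + w ^ 2 = p ∧ u % 2 = 1 ∧ w % 2 = 0 := by
    rcases hpar with ⟨hs1, ht0⟩ | ⟨hs0, ht1⟩
    · exact ⟨s, t, by linarith, hs1, ht0⟩
    · exact ⟨t, s, by linarith, ht1, hs0⟩
  -- `w ≠ 0`: otherwise `p = u² + 2v² ≡ 3 (mod 8)`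
  have hu8 : u ^ 2 % 8 = 1 := sq_mod_eight_of_odd hu
  have hv8 : v ^ 2 % 8 = 1 := sq_mod_eight_of_odd hv
  have hw0 : w ≠ 0 := by
    rintro rfl
    omega
  -- `m = u² + 2v² = p − w² ≡ 3 (mod 8)`: `w` even and `u² + 2v² + w² ≡ 7` force `w² ≡ 4 (mod 8)`
  have hm3 : (u ^ 2 + 2 * v ^ 2) % 8 = 3 := by
    rcases sq_mod_eight_cases w with ⟨hw1, _⟩ | ⟨_, hw8⟩ | ⟨_, hw8⟩ <;> omega
  obtain ⟨ℓ, hℓ, hℓm, hℓ8⟩ := exists_prime_dvd_mod_eight_eq_three (m := u ^ 2 + 2 * v ^ 2) rfl hm3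
  have hmpos : 0 < u ^ 2 + 2 * v ^ 2 := by omega
  have hℓle : ℓ ≤ u ^ 2 + 2 * v ^ 2 := Nat.le_of_dvd hmpos hℓm
  have hw1 : 1 ≤ w ^ 2 := Nat.one_le_pow 2 w (Nat.pos_of_ne_zero hw0)
  have hℓlt : ℓ < p := by omega
  refine ⟨u, v, w, ℓ, huw, hu, hw, hw0, hℓ, hℓm, hℓ8, hℓlt, ?_⟩
  -- the symbol: `w² ≡ p (mod ℓ)`, `(p/ℓ) = 1`, reciprocity at two primes `≡ 3 (mod 4)`
  haveI : Fact p.Prime := ⟨hp⟩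
  haveI : Fact ℓ.Prime := ⟨hℓ⟩
  have hcast : ((u ^ 2 + 2 * v ^ 2 + w ^ 2 : ℕ) : ZMod ℓ) = ((p : ℕ) : ZMod ℓ) := by rw [huw]
  have hzero : ((u ^ 2 + 2 * v ^ 2 : ℕ) : ZMod ℓ) = 0 := (ZMod.natCast_eq_zero_iff _ _).mpr hℓm
  push_cast at hcast hzero
  have hsq : IsSquare (((p : ℤ) : ℤ) : ZMod ℓ) := by
    refine ⟨(w : ZMod ℓ), ?_⟩
    push_cast
    linear_combination -hcast + hzero
  have hne : (((p : ℤ) : ℤ) : ZMod ℓ) ≠ 0 := by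
    have hndvd : ¬ ℓ ∣ p := by
      intro h
      have := (Nat.prime_dvd_prime_iff_eq hℓ hp).mp h
      omega
    intro h
    apply hndvd
    apply (ZMod.natCast_eq_zero_iff p ℓ).mp
    exact_mod_cast h
  have h1 : legendreSym ℓ (p : ℤ) = 1 := (legendreSym.eq_one_iff ℓ hne).mpr hsq
  rw [← jacobiSym.legendreSym.to_jacobiSym p,
    legendreSym.quadratic_reciprocity_three_mod_four (p := ℓ) (q := p) (by omega) (by omega), h1]

/-- **The dual pin for `p ≡ 7 (mod 8)`** (card `three-squares-heegner-pin`, `TernaryPinThreeMinus` restricted to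
`p ≡ 7 (mod 8)`, where no size hypothesis is needed): a prime `ℓ < p` with `ℓ ≡ 3 (mod 8)` and `(ℓ/p) = −1`
(type `(3,−)`). The `p ≡ 3 (mod 8)` half of the card's statement needs a non-degenerate representation
(`h(−8p) > 2`) and is NOT proved here. [folklore] -/
theorem ternaryPinThreeMinus_of_mod_eight_eq_seven : ∀ p : ℕ, p.Prime → p % 8 = 7 →
    ∃ ℓ : ℕ, ℓ.Prime ∧ ℓ < p ∧ ℓ % 8 = 3 ∧ jacobiSym (ℓ : ℤ) p = -1 := by
  intro p hp hp8
  obtain ⟨-, -, -, ℓ, -, -, -, -, hℓ, -, hℓ8, hℓlt, hJ⟩ := exists_ternary_certificate hp hp8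
  exact ⟨ℓ, hℓ, hℓlt, hℓ8, hJ⟩

/-- `2` splits in `ℚ(√−5ℓ′)`: for `ℓ′ ≡ 3 (mod 8)`, `−5ℓ′ ≡ 1 (mod 8)`. [folklore] -/
theorem neg_five_mul_emod_eight {ℓ : ℕ} (hℓ8 : ℓ % 8 = 3) : (-(5 * (ℓ : ℤ))) % 8 = 1 := by
  omega

/-- `(−5/p) = −1` (Jacobi symbol) for `p ≡ 3 (mod 4)` with `p ≡ ±1 (mod 5)`: `(−1/p) = −1`, `(5/p) = (p/5) = +1`.
[folklore] -/
theorem jacobiSym_neg_five {p : ℕ} (hp4 : p % 4 = 3) (hp5 : p % 5 = 1 ∨ p % 5 = 4) :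
    jacobiSym (-5) p = -1 := by
  have hpodd : Odd p := Nat.odd_iff.mpr (by omega)
  have h5 : jacobiSym 5 p = 1 := by
    have hrec := jacobiSym.quadratic_reciprocity_one_mod_four (a := 5) (b := p) (by norm_num) hpodd
    have hcast : ((5 : ℕ) : ℤ) = 5 := by norm_num
    rw [hcast] at hrec
    rw [hrec, jacobiSym.mod_left (p : ℤ) 5]
    rcases hp5 with h | h
    · have h15 : (p : ℤ) % ((5 : ℕ) : ℤ) = 1 := by
        push_cast
        omega
      rw [h15]
      exact jacobiSym.one_left 5
    · have h45 : (p : ℤ) % ((5 : ℕ) : ℤ) = 2 ^ 2 := by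
        push_cast
        omega
      rw [h45]
      exact jacobiSym.sq_one' (by decide)
  have hm1 : jacobiSym (-1) p = -1 := by
    rw [jacobiSym.at_neg_one hpodd, ZMod.χ₄_nat_eq_if_mod_four, if_neg (by omega), if_neg (by omega)]
  have : (-5 : ℤ) = (-1) * 5 := by norm_num
  rw [this, jacobiSym.mul_left, hm1, h5]
  norm_num

/-- **The dual pin with the Heegner data of `K′ = ℚ(√−5ℓ′)`** (the card's corner `E_{2p}`, `p ≡ 3 (mod 4)`,
`p ≡ ±1 (mod 5)`, here for `p ≡ 7 (mod 8)`): a prime `ℓ′ < p`, `ℓ′ ≡ 3 (mod 8)`, `(ℓ′/p) = −1`, with `d = −5ℓ′ ≡ 1 (mod 8)`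
(`2` split), `(d/p) = +1` (`p` split) and `|d| = 5ℓ′ < 5p`. Nothing about `L`-values or class numbers is asserted.
[folklore] -/
theorem exists_dualPin_heegnerData {p : ℕ} (hp : p.Prime) (hp8 : p % 8 = 7) (hp5 : p % 5 = 1 ∨ p % 5 = 4) :
    ∃ ℓ : ℕ, ℓ.Prime ∧ ℓ < p ∧ ℓ % 8 = 3 ∧ jacobiSym (ℓ : ℤ) p = -1 ∧
      (-(5 * (ℓ : ℤ))) % 8 = 1 ∧ jacobiSym (-(5 * (ℓ : ℤ))) p = 1 ∧ 5 * ℓ < 5 * p := by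
  obtain ⟨ℓ, hℓ, hℓlt, hℓ8, hJ⟩ := ternaryPinThreeMinus_of_mod_eight_eq_seven p hp hp8
  refine ⟨ℓ, hℓ, hℓlt, hℓ8, hJ, neg_five_mul_emod_eight hℓ8, ?_, by omega⟩
  have : (-(5 * (ℓ : ℤ))) = (-5) * (ℓ : ℤ) := by ring
  rw [this, jacobiSym.mul_left, jacobiSym_neg_five (by omega) hp5, hJ]
  norm_num


end Summit.BirchSwinnertonDyer.BirchSwinnertonDyer.Theorems.BiquadraticEisensteinDescentHeegnerTwistCouplingInSupplyThreeSquaresPinDual
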